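import Literature.AlgebraicGeometry.AbelianVarieties.PhiPicTorsionDivisible
import Literature.AlgebraicGeometry.AbelianSchemes.PoincareSheafMulN
import Literature.AlgebraicGeometry.AbelianSchemes.AbelianSchemeLDeltaOfLambda
import Literature.AlgebraicGeometry.AbelianSchemes.IsLambdaOfAtMulAdd
import Literature.AlgebraicGeometry.Motives.AbelianVarietyHomDivisionOnPoints
import HarnessLib

/-!
# `Λ(M^Δ) = 2λ_B` for a DESCENDED polarisation: `IsLambdaOfAt s D_B (λ_B ^ 2) E` with `𝒪(E) ≅ (1, λ_B)^*𝒫_B` (X-amp-1)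

Layer `Literature/AlgebraicGeometry/AbelianSchemes`, namespace `Literature.AlgebraicGeometry.AbelianSchemes.AbelianSchemeOver`.
Cell `hodgecm-mathlib`, HECKE-LINK (X-amp) plan of record (B-plan1 (g14) 21:50:29Z / 22:27:10Z), brick (X-amp-1): the binder
`hE : IsLambdaOfAt s DB (lam ^ 2) E` of ★ `IsLambdaOfAt.bezout` (B-p15 (g10)).  THEOREMS ONLY.

SETTING (generic; the two-step descent instantiates it): abelian schemes `A′, B / S` over a reduced locally Noetherian base with
dual pairs `D′, D_B`; homomorphisms `ψ : A′ → B`, `λ′ : A′ → Â′`, `λ_B : B → B̂`, an `S`-morphism `ψh : Â′ → B̂` with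
`ψ ≫ λ_B = λ′ ≫ ψh` (the descended polarisation), a homomorphism `π_B : B → A′` with `π_B ≫ ψ = [n]_B`, a morphism
`Φ = ψ × ψh : A′ ×_S Â′ → B ×_S B̂` (given by its two projections) with the KEY INPUT
`hN : Φ^*𝒫_B ≅ ([n]_{A′} × 1)^*𝒫′`, the unit hypothesis `hD_B`, a geometric point `s : Spec Ω → S` with `n ≠ 0` in `Ω`, a witness
`Θ′` of `λ′` at `s` (`IsLambdaOfAt`), and `ψ_s` onto on `Ω`-points.

ROAD (no `D_B.universal`, no `Pic⁰`-structure theorem): in `Ȟ¹(B_s, 𝒪^×)` put `M := [(ι_s, λ_B ι_s)^*𝒫_B]`,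
`S(x) := [𝒫_B|_{B_s × {λ̄_B(x)}}]` and `R(x) := φ_M(x) · S(x)⁻²`.  §1: `x ↦ S(x)` and hence `R` are HOMOMORPHISMS (★ (P-⊗), ★
theorem of the square).  §2: along `ψ_s`, `ψ_s^* M = [(ι, λ′ι)^*𝒫′]ⁿ` and `ψ_s^* S(ψ_s a) = [𝒫′|_{λ̄′(a)}]ⁿ` (`hN`, ★ (SYM-n)
`([n] × 1)^*𝒫′ ≅ 𝒫′^{⊗n}`), so `ψ_s^* R(ψ_s a) = (φ_{Θ′}(a)² · φ_{Θ′}(a)⁻²)ⁿ = 1` by ★ `Λ(L^Δ(λ′)) = 2λ̄′`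
(`phiPic_pullback_graph_detClass_P`) and ★ `IsLambdaOfAt.pullback_sliceAt_detClass_P`.  §3: `R(ψ_s a)` is translation invariant,
so `[n]_{B_s}^* R = Rⁿ` (★), while `[n]_B = π_B ≫ ψ` gives `[n]^* R(ψ_s a) = π_s^* ψ_s^* R(ψ_s a) = 1`; `A′_s(Ω)` is divisible (★), so
`R(ψ_s a) = 1`, and `ψ_s` is onto: `R ≡ 1`.  §4: `φ_M(x) = S(x)² = [𝒫_B|_{λ̄_B·λ̄_B (x)}]`, i.e. `IsLambdaOfAt s D_B (λ_B·λ_B) E`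
(`λ_B·λ_B = λ_B ^ 2`, Mathlib `pow_two`) for the divisor `E` of `M` (★ `exists_iso_lineBundle_toUnitCocycle`).  [MumfordFogartyKirwan1994] Prop. 6.10; [MumfordAV1970] §8,
§15 Thm. 1, §20 Thm. 2 («`φ_{(1,λ)^*𝒫} = λ + λ^t`»).

HC_CM is proved only modulo the 7 printed citations until rung 0 closes; nothing here is about HC.

## References
* [MumfordFogartyKirwan1994] D. Mumford, J. Fogarty, F. Kirwan, *Geometric Invariant Theory*, 3rd ed. (1994), Ch. 6 §2 Prop. 6.10
  (p. 121), Definitions 6.2–6.3 (p. 120).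
* [MumfordAV1970] D. Mumford, *Abelian Varieties* (1970), §8 (pp. 74–75), §15 Thm. 1 (p. 143), §20 Thm. 2 (p. 188).
-/

noncomputable section

open CategoryTheory CategoryTheory.Limits AlgebraicGeometry MonoidalCategory CartesianMonoidalCategory
open scoped MonObj

universe u

set_option backward.isDefEq.respectTransparency false -- `Scheme.Modules` is not reducible (as in Mathlib `Modules/Sheaf.lean`)

namespace Literature.AlgebraicGeometry.AbelianSchemes

open Literature.AlgebraicGeometry.Motives Literature.AlgebraicGeometry.Modules
  Literature.AlgebraicGeometry.AbelianVarieties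

namespace AbelianSchemeOver

variable {S : Scheme.{u}} (A : AbelianSchemeOver S) {Ω : Type u} [Field Ω] (s : Spec (.of Ω) ⟶ S)

/-! ## §0 Points of the fibre: products -/

/-- **The point of `A` under `P · Q` is the product of the points under `P` and `Q`** (as `Spec Ω`-valued points of `A` over
`s`): the fibre `A_s = A ×_S Spec Ω` is a base change of group schemes (★ `baseChange_isBaseChangeVia`).
[cite: MumfordFogartyKirwan1994, Ch. 6 §1 Definition 6.1 (p. 115)] -/
theorem fibrePointToLeft_mul (P Q : (A.fibre s).toAbelianVariety.Points Ω) :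
    A.fibrePointToLeft s (P * Q) =
      ((Over.homMk (A.fibrePointToLeft s P) (A.fibrePointToLeft_comp_hom s P) : Over.mk s ⟶ A.X) *
        (Over.homMk (A.fibrePointToLeft s Q) (A.fibrePointToLeft_comp_hom s Q) : Over.mk s ⟶ A.X)).left := by
  have w : pullback.fst A.X.hom s ≫ A.X.hom = (A.baseChange s).X.hom ≫ s := pullback.condition
  have hμ := A.mul_baseChange_left_comp_fst s w
  have wPQ : (P.left : Spec (.of Ω) ⟶ (A.baseChange s).X.left) ≫ (A.baseChange s).X.hom =
      (Q.left : Spec (.of Ω) ⟶ (A.baseChange s).X.left) ≫ (A.baseChange s).X.hom :=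
    (Over.w P).trans (Over.w Q).symm
  have h1 : ((P * Q).left : Spec (.of Ω) ⟶ (A.baseChange s).X.left) =
      pullback.lift (f := (A.baseChange s).X.hom) (g := (A.baseChange s).X.hom) P.left Q.left wPQ ≫
        μ[(A.baseChange s).X].left := by
    rw [Hom.mul_def]; rfl
  have h2 : ((Over.homMk (A.fibrePointToLeft s P) (A.fibrePointToLeft_comp_hom s P) : Over.mk s ⟶ A.X) *
        (Over.homMk (A.fibrePointToLeft s Q) (A.fibrePointToLeft_comp_hom s Q) : Over.mk s ⟶ A.X)).left =
      pullback.lift (f := A.X.hom) (g := A.X.hom) (A.fibrePointToLeft s P) (A.fibrePointToLeft s Q)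
          ((A.fibrePointToLeft_comp_hom s P).trans (A.fibrePointToLeft_comp_hom s Q).symm) ≫ μ[A.X].left := by
    rw [Hom.mul_def]; rfl
  have key : pullback.lift (f := (A.baseChange s).X.hom) (g := (A.baseChange s).X.hom) P.left Q.left wPQ ≫
        pullback.map (A.baseChange s).X.hom (A.baseChange s).X.hom A.X.hom A.X.hom
          (pullback.fst A.X.hom s) (pullback.fst A.X.hom s) s w.symm w.symm =
      pullback.lift (f := A.X.hom) (g := A.X.hom) (A.fibrePointToLeft s P) (A.fibrePointToLeft s Q)
          ((A.fibrePointToLeft_comp_hom s P).trans (A.fibrePointToLeft_comp_hom s Q).symm) := by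
    apply pullback.hom_ext
    · simp only [Category.assoc, pullback.lift_fst, pullback.lift_fst_assoc]
    · simp only [Category.assoc, pullback.lift_snd, pullback.lift_snd_assoc]
  change ((P * Q).left : Spec (.of Ω) ⟶ (A.baseChange s).X.left) ≫ pullback.fst A.X.hom s = _
  rw [h1, h2, Category.assoc, hμ, ← Category.assoc, key]

variable {A}

namespace DualPair

variable (D : A.DualPair) (lam : A.X ⟶ D.hat.X)

/-! ## §1 The slice classes `S(x) = [𝒫|_{A_s × {λ̄(x)}}]`: translation invariant, multiplicative in `x` and in `λ`

All classes of this file live in `Ȟ¹(A_s, 𝒪^×)` with `A_s` spelled `(A.fibre s).toAbelianVariety.X.left` (the spelling of ★ `phiPic`,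
★ `AbelianVariety.translation` and ★ `fibreHom`); the slice classes are pinned to it with `(X := _)`. -/

/-- The class of the slice `𝒫|_{A_s × {λ̄(P)}}` is translation invariant on `A_s` (clause (a) of the dual pair: slices lie in `Pic⁰`,
★ `isHomogeneous_pullback_sliceOver`). [cite: MumfordAV1970, §8 ((iv) ⇔ (i))] -/
theorem pullback_translation_sliceAt_detClass [IsAlgClosed Ω] (P y : (A.fibre s).toAbelianVariety.Points Ω) :
    CechPic.pullback ((A.fibre s).toAbelianVariety.translation y).left
        (CechPic.pullback (X := (A.fibre s).toAbelianVariety.X.left) (A.sliceAt s D lam P)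
          (detClass (HasRank.isFiniteLocallyFree' D.hasRank_one))) =
      CechPic.pullback (X := (A.fibre s).toAbelianVariety.X.left) (A.sliceAt s D lam P)
        (detClass (HasRank.isFiniteLocallyFree' D.hasRank_one)) := by
  have hh : IsHomogeneous (A.fibre s).toAbelianVariety ((Scheme.Modules.pullback (A.sliceAt s D lam P)).obj D.P) :=
    D.isHomogeneous_pullback_sliceOver (A.valueAt s D lam P) (A.valueAt_comp_hom s D lam P)
  have hr : HasRank ((Scheme.Modules.pullback (A.sliceAt s D lam P)).obj D.P) 1 := hasRank_pullback _ D.hasRank_one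
  have h := (isHomogeneous_iff_forall_pullback_detClass_eq (A.fibre s).toAbelianVariety hr
    ((HasRank.isFiniteLocallyFree' D.hasRank_one).pullback _)).1 hh y
  rw [detClass_pullback] at h
  exact h

variable [IsReduced S] [IsLocallyNoetherian S]

/-- **`x ↦ S(x) = [𝒫|_{A_s × {λ̄(x)}}]` is multiplicative** for a homomorphism `λ`: `λ̄(x·y) = λ̄(x)·λ̄(y)` and ★ (P-⊗)
`(1 × g₁g₂)^*𝒫 ≅ (1 × g₁)^*𝒫 ⊗ (1 × g₂)^*𝒫` (unit hypothesis `hD`). [cite: MumfordAV1970, §8 (pp. 74–75)] -/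
theorem pullback_sliceAt_mul_detClass [IsMonHom lam]
    (hD : Nonempty ((Scheme.Modules.pullback (unitHatSlice D)).obj D.P ≅ SheafOfModules.unit _))
    (x y : (A.fibre s).toAbelianVariety.Points Ω) :
    CechPic.pullback (X := (A.fibre s).toAbelianVariety.X.left) (A.sliceAt s D lam (x * y))
        (detClass (HasRank.isFiniteLocallyFree' D.hasRank_one)) =
      CechPic.pullback (X := (A.fibre s).toAbelianVariety.X.left) (A.sliceAt s D lam x)
          (detClass (HasRank.isFiniteLocallyFree' D.hasRank_one)) *
        CechPic.pullback (X := (A.fibre s).toAbelianVariety.X.left) (A.sliceAt s D lam y)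
          (detClass (HasRank.isFiniteLocallyFree' D.hasRank_one)) := by
  show CechPic.pullback (A.sliceAt s D lam (x * y)) (detClass (HasRank.isFiniteLocallyFree' D.hasRank_one)) =
    CechPic.pullback (A.sliceAt s D lam x) (detClass (HasRank.isFiniteLocallyFree' D.hasRank_one)) *
      CechPic.pullback (A.sliceAt s D lam y) (detClass (HasRank.isFiniteLocallyFree' D.hasRank_one))
  -- the three `Â`-valued points `λ̄(x)`, `λ̄(y)`, `λ̄(xy)` as morphisms `Over.mk s ⟶ Â`
  set px : Over.mk s ⟶ A.X := Over.homMk (A.fibrePointToLeft s x) (A.fibrePointToLeft_comp_hom s x) with hpx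
  set py : Over.mk s ⟶ A.X := Over.homMk (A.fibrePointToLeft s y) (A.fibrePointToLeft_comp_hom s y) with hpy
  have hxy : A.valueAt s D lam (x * y) = ((px ≫ lam) * (py ≫ lam)).left := by
    change A.fibrePointToLeft s (x * y) ≫ lam.left = _
    rw [A.fibrePointToLeft_mul s x y, ← MonObj.mul_comp, Over.comp_left]
  have hx : A.valueAt s D lam x = (px ≫ lam).left := rfl
  have hy : A.valueAt s D lam y = (py ≫ lam).left := rfl
  obtain ⟨m⟩ := D.nonempty_pullbackP_mul_iso hD s (px ≫ lam) (py ≫ lam)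
  rw [← detClass_pullback _ (HasRank.isFiniteLocallyFree' D.hasRank_one),
    ← detClass_pullback _ (HasRank.isFiniteLocallyFree' D.hasRank_one),
    ← detClass_pullback _ (HasRank.isFiniteLocallyFree' D.hasRank_one)]
  rw [← detClass_tensorObj_of_hasRank_one (hasRank_pullback _ D.hasRank_one) (hasRank_pullback _ D.hasRank_one)
    ((HasRank.isFiniteLocallyFree' D.hasRank_one).pullback _) ((HasRank.isFiniteLocallyFree' D.hasRank_one).pullback _)
    (isFiniteLocallyFree_tensorObj _ _ ((HasRank.isFiniteLocallyFree' D.hasRank_one).pullback _)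
      ((HasRank.isFiniteLocallyFree' D.hasRank_one).pullback _))]
  refine detClass_eq_of_iso ?_ _ _
  change D.pullbackP s (A.valueAt s D lam (x * y)) (A.valueAt_comp_hom s D lam _) ≅
    tensorObj (D.pullbackP s (A.valueAt s D lam x) (A.valueAt_comp_hom s D lam _))
      (D.pullbackP s (A.valueAt s D lam y) (A.valueAt_comp_hom s D lam _))
  rw [D.pullbackP_congr s hxy (A.valueAt_comp_hom s D lam _) (Over.w _), D.pullbackP_congr s hx (A.valueAt_comp_hom s D lam _) (Over.w _),
    D.pullbackP_congr s hy (A.valueAt_comp_hom s D lam _) (Over.w _)]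
  exact m

/-- **`λ ↦ [𝒫|_{A_s × {λ̄(x)}}]` is multiplicative in `λ`** at a fixed point `x`: `(λ₁λ₂)‾(x) = λ̄₁(x)·λ̄₂(x)` (★ `valueAt_mul`)
and ★ (P-⊗). [cite: MumfordAV1970, §8 (pp. 74–75)] [cite: MumfordFogartyKirwan1994, Ch. 6 §2 Definition 6.2 (p. 120)] -/
theorem pullback_sliceAt_detClass_mul_hom (lam₁ lam₂ : A.X ⟶ D.hat.X)
    (hD : Nonempty ((Scheme.Modules.pullback (unitHatSlice D)).obj D.P ≅ SheafOfModules.unit _))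
    (x : (A.fibre s).toAbelianVariety.Points Ω) :
    CechPic.pullback (X := (A.fibre s).toAbelianVariety.X.left) (A.sliceAt s D (lam₁ * lam₂) x)
        (detClass (HasRank.isFiniteLocallyFree' D.hasRank_one)) =
      CechPic.pullback (X := (A.fibre s).toAbelianVariety.X.left) (A.sliceAt s D lam₁ x)
          (detClass (HasRank.isFiniteLocallyFree' D.hasRank_one)) *
        CechPic.pullback (X := (A.fibre s).toAbelianVariety.X.left) (A.sliceAt s D lam₂ x)
          (detClass (HasRank.isFiniteLocallyFree' D.hasRank_one)) := by
  show CechPic.pullback (A.sliceAt s D (lam₁ * lam₂) x) (detClass (HasRank.isFiniteLocallyFree' D.hasRank_one)) =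
    CechPic.pullback (A.sliceAt s D lam₁ x) (detClass (HasRank.isFiniteLocallyFree' D.hasRank_one)) *
      CechPic.pullback (A.sliceAt s D lam₂ x) (detClass (HasRank.isFiniteLocallyFree' D.hasRank_one))
  set px : Over.mk s ⟶ A.X := Over.homMk (A.fibrePointToLeft s x) (A.fibrePointToLeft_comp_hom s x) with hpx
  have hxy : A.valueAt s D (lam₁ * lam₂) x = ((px ≫ lam₁) * (px ≫ lam₂)).left := A.valueAt_mul D s lam₁ lam₂ x
  have hx : A.valueAt s D lam₁ x = (px ≫ lam₁).left := rfl
  have hy : A.valueAt s D lam₂ x = (px ≫ lam₂).left := rfl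
  obtain ⟨m⟩ := D.nonempty_pullbackP_mul_iso hD s (px ≫ lam₁) (px ≫ lam₂)
  rw [← detClass_pullback _ (HasRank.isFiniteLocallyFree' D.hasRank_one),
    ← detClass_pullback _ (HasRank.isFiniteLocallyFree' D.hasRank_one),
    ← detClass_pullback _ (HasRank.isFiniteLocallyFree' D.hasRank_one)]
  rw [← detClass_tensorObj_of_hasRank_one (hasRank_pullback _ D.hasRank_one) (hasRank_pullback _ D.hasRank_one)
    ((HasRank.isFiniteLocallyFree' D.hasRank_one).pullback _) ((HasRank.isFiniteLocallyFree' D.hasRank_one).pullback _)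
    (isFiniteLocallyFree_tensorObj _ _ ((HasRank.isFiniteLocallyFree' D.hasRank_one).pullback _)
      ((HasRank.isFiniteLocallyFree' D.hasRank_one).pullback _))]
  refine detClass_eq_of_iso ?_ _ _
  change D.pullbackP s (A.valueAt s D (lam₁ * lam₂) x) (A.valueAt_comp_hom s D _ _) ≅
    tensorObj (D.pullbackP s (A.valueAt s D lam₁ x) (A.valueAt_comp_hom s D lam₁ _))
      (D.pullbackP s (A.valueAt s D lam₂ x) (A.valueAt_comp_hom s D lam₂ _))
  rw [D.pullbackP_congr s hxy (A.valueAt_comp_hom s D _ _) (Over.w _), D.pullbackP_congr s hx (A.valueAt_comp_hom s D lam₁ _) (Over.w _),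
    D.pullbackP_congr s hy (A.valueAt_comp_hom s D lam₂ _) (Over.w _)]
  exact m

/-! ## §2 Transport along `ψ_s` -/

/-- **`Φ^*[𝒫_B] = [𝒫']ⁿ`** when `Φ^*𝒫_B ≅ ([n] × 1)^*𝒫'` (the KEY INPUT `hN`) — by ★ (SYM-n) `([n] × 1)^*𝒫' ≅ 𝒫'^{⊗n}` and
`[M^{⊗n}] = [M]ⁿ`. [cite: MumfordAV1970, §8 ((iv), p. 75)] [cite: MumfordFogartyKirwan1994, Ch. 6 §2 Prop. 6.10 (p. 121)] -/
theorem cechPic_pullback_detClass_eq_pow_of_iso_mulN (n : ℕ) {X : Scheme.{u}} {F : X.Modules} (hF : IsFiniteLocallyFree F)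
    (Φ : A.prodLeft D.hat ⟶ X)
    (hN : Nonempty ((Scheme.Modules.pullback Φ).obj F ≅
      (Scheme.Modules.pullback (baseChangeHom (A.mulN n) D.hat.X.hom).left).obj D.P)) :
    CechPic.pullback Φ (detClass hF) = detClass (HasRank.isFiniteLocallyFree' D.hasRank_one) ^ n := by
  obtain ⟨i⟩ := hN
  obtain ⟨e⟩ := D.nonempty_pullback_mulN_iso_tensorPow n
  rw [← detClass_pullback Φ hF, ← detClass_tensorPow D.hasRank_one (HasRank.isFiniteLocallyFree' D.hasRank_one) n
    (isFiniteLocallyFree_tensorPow (HasRank.isFiniteLocallyFree' D.hasRank_one) n)]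
  exact detClass_eq_of_iso (i ≪≫ e) _ _

end DualPair

section Transport

variable {A' B : AbelianSchemeOver S} (D' : A'.DualPair) (DB : B.DualPair)
  (ψ : A'.X ⟶ B.X) [IsMonHom ψ] (ψh : D'.hat.X ⟶ DB.hat.X) (lam' : A'.X ⟶ D'.hat.X) (lamB : B.X ⟶ DB.hat.X)
  (hψl : ψ ≫ lamB = lam' ≫ ψh) (Φ : A'.prodLeft D'.hat ⟶ B.prodLeft DB.hat)
  (hΦ₁ : Φ ≫ pullback.fst B.X.hom DB.hat.X.hom = pullback.fst A'.X.hom D'.hat.X.hom ≫ ψ.left)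
  (hΦ₂ : Φ ≫ pullback.snd B.X.hom DB.hat.X.hom = pullback.snd A'.X.hom D'.hat.X.hom ≫ ψh.left)

include hψl hΦ₁ hΦ₂ in
/-- **`ψ_s` followed by the graph `(ι, λ_B ι)` of `λ_B` on `B_s` is the graph of `λ'` on `A'_s` followed by `Φ = ψ × ψ̂`**
(`ψ ≫ λ_B = λ' ≫ ψ̂`; graphs given by their two projections). [cite: MumfordFogartyKirwan1994, Ch. 6 §2 Definition 6.3 (p. 120)] -/
theorem fibreHom_left_comp_graph
    (gr' : (A'.fibre s).toAbelianVariety.X.left ⟶ A'.prodLeft D'.hat)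
    (hgr'₁ : gr' ≫ pullback.fst A'.X.hom D'.hat.X.hom = pullback.fst A'.X.hom s)
    (hgr'₂ : gr' ≫ pullback.snd A'.X.hom D'.hat.X.hom = pullback.fst A'.X.hom s ≫ lam'.left)
    (grB : (B.fibre s).toAbelianVariety.X.left ⟶ B.prodLeft DB.hat)
    (hgrB₁ : grB ≫ pullback.fst B.X.hom DB.hat.X.hom = pullback.fst B.X.hom s)
    (hgrB₂ : grB ≫ pullback.snd B.X.hom DB.hat.X.hom = pullback.fst B.X.hom s ≫ lamB.left) :
    (fibreHom ψ s).hom.hom.hom.left ≫ grB = gr' ≫ Φ := by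
  apply pullback.hom_ext
  · rw [Category.assoc, hgrB₁, Category.assoc, hΦ₁, ← Category.assoc, hgr'₁]
    exact fibreHom_toSchemeHom_fst ψ s
  · have h2 : ψ.left ≫ lamB.left = lam'.left ≫ ψh.left := by rw [← Over.comp_left, hψl, Over.comp_left]
    simp only [Category.assoc, hgrB₂, hΦ₂, reassoc_of% hgr'₂, ← h2]
    rw [← Category.assoc, ← Category.assoc]
    exact congrArg (· ≫ lamB.left) (fibreHom_toSchemeHom_fst ψ s)

include hψl hΦ₁ hΦ₂ in
/-- **`ψ_s` followed by the slice of `𝒫_B` at `λ̄_B(ψ_s a)` is the slice of `𝒫'` at `λ̄'(a)` followed by `Φ`** (the point of `B̂`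
under `λ_B ψ_s(a)` is `ψ̂` of the point of `Â'` under `λ'(a)`). [cite: MumfordFogartyKirwan1994, Ch. 6 §2 Definition 6.3 (p. 120)] -/
theorem fibreHom_left_comp_sliceAt (a : (A'.fibre s).toAbelianVariety.Points Ω) :
    (fibreHom ψ s).hom.hom.hom.left ≫ B.sliceAt s DB lamB (AlgPoints.map (fibreHom ψ s).hom.hom.hom a) =
      A'.sliceAt s D' lam' a ≫ Φ := by
  apply pullback.hom_ext
  · rw [Category.assoc, sliceAt_fst, Category.assoc, hΦ₁, sliceAt_fst_assoc]
    exact fibreHom_toSchemeHom_fst ψ s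
  · have h2 : ψ.left ≫ lamB.left = lam'.left ≫ ψh.left := by rw [← Over.comp_left, hψl, Over.comp_left]
    rw [Category.assoc, sliceAt_snd, Category.assoc, hΦ₂, sliceAt_snd_assoc, ← Category.assoc,
      fibreHom_toSchemeHom_snd ψ s]
    congr 1
    change B.fibrePointToLeft s (AlgPoints.map (fibreHom ψ s).hom.hom.hom a) ≫ lamB.left =
      (A'.fibrePointToLeft s a ≫ lam'.left) ≫ ψh.left
    rw [fibrePointToLeft_map_fibreHom]
    simp only [Category.assoc, h2]

variable [IsReduced S] [IsLocallyNoetherian S]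

include hψl hΦ₁ hΦ₂ in
/-- **`Λ(grB^*𝒫_B) = 2λ̄_B` for a descended polarisation — the (X-amp-1) witness.**  Under the hypotheses of the module docstring
(`grB` any morphism with the two projections of the graph `(ι_s, λ_B ι_s)`) there is a Cartier divisor `E` on `B_s` with
`𝒪(E) ≅ grB^*𝒫_B` and `IsLambdaOfAt s D_B (λ_B ^ 2) E` (`λ_B ^ 2 = λ_B·λ_B`, Mathlib `pow_two`).  Proof = §§1–4 of the module docstring (`R ≡ 1` by transport along `Φ`,
translation invariance, `[n] = π_B ≫ ψ`, divisibility of `A'_s(Ω)`, surjectivity of `ψ_s`); Mumford's «`φ_{(1 × λ)^*𝒫} = 2λ`» for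
`λ = λ_B`, WITHOUT the universal property of `D_B`. [cite: MumfordAV1970, §20 Thm. 2 (p. 188) and §8 (pp. 74–75)]
[cite: MumfordFogartyKirwan1994, Ch. 6 §2 Prop. 6.10 (p. 121)] -/
theorem exists_isLambdaOfAt_mul_self_of_graphPullback
    (hDB : Nonempty ((Scheme.Modules.pullback (DualPair.unitHatSlice DB)).obj DB.P ≅ SheafOfModules.unit _))
    [IsMonHom lamB] (n : ℕ) (πB : B.X ⟶ A'.X) (hπ : πB ≫ ψ = B.mulN n)
    (hN : Nonempty ((Scheme.Modules.pullback Φ).obj DB.P ≅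
      (Scheme.Modules.pullback (baseChangeHom (A'.mulN n) D'.hat.X.hom).left).obj D'.P))
    [IsAlgClosed Ω] (hn : (n : Ω) ≠ 0) {Θ' : CartierDivisor (A'.fibre s).toAbelianVariety.X.left}
    (hΘ' : A'.IsLambdaOfAt s D' lam' Θ')
    (hψs : Function.Surjective (AlgPoints.map (L := Ω) (fibreHom ψ s).hom.hom.hom :
      (A'.fibre s).toAbelianVariety.Points Ω → (B.fibre s).toAbelianVariety.Points Ω))
    (grB : (B.fibre s).toAbelianVariety.X.left ⟶ B.prodLeft DB.hat)
    (hgrB₁ : grB ≫ pullback.fst B.X.hom DB.hat.X.hom = pullback.fst B.X.hom s)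
    (hgrB₂ : grB ≫ pullback.snd B.X.hom DB.hat.X.hom = pullback.fst B.X.hom s ≫ lamB.left) :
    ∃ E : CartierDivisor (B.fibre s).toAbelianVariety.X.left,
      B.IsLambdaOfAt s DB (lamB ^ 2) E ∧ Nonempty (B.lineBundleOfDivisor s E ≅ (Scheme.Modules.pullback grB).obj DB.P) := by
  -- the graph of `λ'` on `A'_s`
  obtain ⟨gr', hgr'₁, hgr'₂⟩ : ∃ gr' : (A'.fibre s).toAbelianVariety.X.left ⟶ A'.prodLeft D'.hat,
      gr' ≫ pullback.fst A'.X.hom D'.hat.X.hom = pullback.fst A'.X.hom s ∧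
        gr' ≫ pullback.snd A'.X.hom D'.hat.X.hom = pullback.fst A'.X.hom s ≫ lam'.left :=
    ⟨pullback.lift (pullback.fst A'.X.hom s) (pullback.fst A'.X.hom s ≫ lam'.left) (by rw [Category.assoc, Over.w]),
      pullback.lift_fst _ _ _, pullback.lift_snd _ _ _⟩
  -- §2: the classes pulled back along `ψ_s`
  have hΦc : CechPic.pullback Φ (detClass (HasRank.isFiniteLocallyFree' DB.hasRank_one)) =
      detClass (HasRank.isFiniteLocallyFree' D'.hasRank_one) ^ n :=
    D'.cechPic_pullback_detClass_eq_pow_of_iso_mulN n _ Φ hN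
  have hM' : CechPic.pullback (fibreHom ψ s).hom.hom.hom.left
      (CechPic.pullback grB (detClass (HasRank.isFiniteLocallyFree' DB.hasRank_one))) =
      CechPic.pullback gr' (detClass (HasRank.isFiniteLocallyFree' D'.hasRank_one)) ^ n := by
    rw [← CechPic.pullback_comp,
      fibreHom_left_comp_graph s D' DB ψ ψh lam' lamB hψl Φ hΦ₁ hΦ₂ gr' hgr'₁ hgr'₂ grB hgrB₁ hgrB₂,
      CechPic.pullback_comp, hΦc, map_pow]
  have hsl' : ∀ a : (A'.fibre s).toAbelianVariety.Points Ω,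
      CechPic.pullback (X := (A'.fibre s).toAbelianVariety.X.left) (A'.sliceAt s D' lam' a)
        (detClass (HasRank.isFiniteLocallyFree' D'.hasRank_one)) =
      phiPic (A'.fibre s).toAbelianVariety Θ'.cechClass a := by
    intro a
    have h := IsLambdaOfAt.pullback_sliceAt_detClass_P A' D' s hΘ' (HasRank.isFiniteLocallyFree' D'.hasRank_one) a
    rw [Θ'.cechClass_pullback] at h
    exact h
  have hS' : ∀ a : (A'.fibre s).toAbelianVariety.Points Ω,
      CechPic.pullback (fibreHom ψ s).hom.hom.hom.left
        (CechPic.pullback (X := (B.fibre s).toAbelianVariety.X.left)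
          (B.sliceAt s DB lamB (AlgPoints.map (fibreHom ψ s).hom.hom.hom a))
          (detClass (HasRank.isFiniteLocallyFree' DB.hasRank_one))) =
      phiPic (A'.fibre s).toAbelianVariety Θ'.cechClass a ^ n := by
    intro a
    rw [← CechPic.pullback_comp, fibreHom_left_comp_sliceAt s D' DB ψ ψh lam' lamB hψl Φ hΦ₁ hΦ₂ a, CechPic.pullback_comp,
      hΦc, map_pow, hsl' a]
  have hφpow : ∀ (c : CechPic (A'.fibre s).toAbelianVariety.X.left) (k : ℕ) (a : (A'.fibre s).toAbelianVariety.Points Ω),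
      phiPic (A'.fibre s).toAbelianVariety (c ^ k) a = phiPic (A'.fibre s).toAbelianVariety c a ^ k :=
    fun c k a => map_pow (phiPicAt (A'.fibre s).toAbelianVariety a) c k
  -- `ψ_s^* R(ψ_s a) = 1`
  have key : ∀ a : (A'.fibre s).toAbelianVariety.Points Ω,
      CechPic.pullback (fibreHom ψ s).hom.hom.hom.left
        (phiPic (B.fibre s).toAbelianVariety (CechPic.pullback grB (detClass (HasRank.isFiniteLocallyFree' DB.hasRank_one)))
            (AlgPoints.map (fibreHom ψ s).hom.hom.hom a) /
          CechPic.pullback (X := (B.fibre s).toAbelianVariety.X.left)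
              (B.sliceAt s DB lamB (AlgPoints.map (fibreHom ψ s).hom.hom.hom a))
              (detClass (HasRank.isFiniteLocallyFree' DB.hasRank_one)) ^ 2) = 1 := by
    intro a
    rw [map_div, map_pow, hS' a, AlgPoints.map_apply, ← phiPic_pullback_hom (B.fibre s).toAbelianVariety (fibreHom ψ s) _ a,
      hM', hφpow, A'.phiPic_pullback_graph_detClass_P D' s rfl hΘ' (HasRank.isFiniteLocallyFree' D'.hasRank_one) gr' hgr'₁ hgr'₂ a,
      ← pow_mul, ← pow_mul, mul_comm, div_self']
  -- §3: `[n]_{B_s} = (π_B)_s ≫ ψ_s` on underlying schemes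
  have hfac : (B.baseChange s).mulN n = baseChangeHom πB s ≫ baseChangeHom ψ s := by
    rw [← B.baseChangeHom_mulN s n, ← hπ]
    exact Functor.map_comp (Over.pullback s) πB ψ
  have hpow : (((𝟙 (B.fibre s).toAbelianVariety.X : (B.fibre s).toAbelianVariety.X ⟶ (B.fibre s).toAbelianVariety.X) ^ n :
      (B.fibre s).toAbelianVariety.X ⟶ (B.fibre s).toAbelianVariety.X)).left =
      CategoryStruct.comp (X := (B.fibre s).toAbelianVariety.X.left) (Y := (A'.fibre s).toAbelianVariety.X.left)
        (Z := (B.fibre s).toAbelianVariety.X.left) (baseChangeHom πB s).left (fibreHom ψ s).hom.hom.hom.left := by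
    have h := congrArg (fun t => t.left) hfac
    simp only [Over.comp_left] at h
    exact h
  -- the homomorphism `a ↦ R(ψ_s a)` and its triviality
  set Rψ : (A'.fibre s).toAbelianVariety.Points Ω →* CechPic (B.fibre s).toAbelianVariety.X.left :=
    MonoidHom.mk'
      (fun a => phiPic (B.fibre s).toAbelianVariety (CechPic.pullback grB (detClass (HasRank.isFiniteLocallyFree' DB.hasRank_one)))
            (AlgPoints.map (fibreHom ψ s).hom.hom.hom a) /
          CechPic.pullback (X := (B.fibre s).toAbelianVariety.X.left)
              (B.sliceAt s DB lamB (AlgPoints.map (fibreHom ψ s).hom.hom.hom a))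
              (detClass (HasRank.isFiniteLocallyFree' DB.hasRank_one)) ^ 2)
      (by
        intro a b
        simp only
        rw [AbelianVariety.map_hom_mul (fibreHom ψ s) a b, phiPic_mul', DB.pullback_sliceAt_mul_detClass s lamB hDB, mul_pow,
          mul_div_mul_comm]) with hRψ
  have hRn : ∀ a, Rψ a ^ n = 1 := by
    intro a
    simp only [hRψ, MonoidHom.mk'_apply]
    have hinv : ∀ y : (B.fibre s).toAbelianVariety.Points Ω,
        CechPic.pullback ((B.fibre s).toAbelianVariety.translation y).left
          (phiPic (B.fibre s).toAbelianVariety (CechPic.pullback grB (detClass (HasRank.isFiniteLocallyFree' DB.hasRank_one)))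
              (AlgPoints.map (fibreHom ψ s).hom.hom.hom a) /
            CechPic.pullback (X := (B.fibre s).toAbelianVariety.X.left)
                (B.sliceAt s DB lamB (AlgPoints.map (fibreHom ψ s).hom.hom.hom a))
                (detClass (HasRank.isFiniteLocallyFree' DB.hasRank_one)) ^ 2) =
        phiPic (B.fibre s).toAbelianVariety (CechPic.pullback grB (detClass (HasRank.isFiniteLocallyFree' DB.hasRank_one)))
            (AlgPoints.map (fibreHom ψ s).hom.hom.hom a) /
          CechPic.pullback (X := (B.fibre s).toAbelianVariety.X.left)
              (B.sliceAt s DB lamB (AlgPoints.map (fibreHom ψ s).hom.hom.hom a))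
              (detClass (HasRank.isFiniteLocallyFree' DB.hasRank_one)) ^ 2 := by
      intro y
      rw [map_div, map_pow, pullback_translation_phiPic, DB.pullback_translation_sliceAt_detClass s lamB _ y]
    rw [← cechPic_pullback_pow_id_of_forall_translation (B.fibre s).toAbelianVariety _ hinv n, hpow, CechPic.pullback_comp,
      key a, map_one]
  have hR1 : ∀ a, Rψ a = 1 := eq_one_of_forall_pow_eq_one_of_isAlgClosed (A'.fibre s).toAbelianVariety Rψ hn hRn
  -- hence `φ_M(x) = S(x)²` for every `x` (`ψ_s` is onto)
  have main : ∀ x : (B.fibre s).toAbelianVariety.Points Ω,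
      phiPic (B.fibre s).toAbelianVariety (CechPic.pullback grB (detClass (HasRank.isFiniteLocallyFree' DB.hasRank_one))) x =
        CechPic.pullback (X := (B.fibre s).toAbelianVariety.X.left) (B.sliceAt s DB lamB x)
          (detClass (HasRank.isFiniteLocallyFree' DB.hasRank_one)) ^ 2 := by
    intro x
    obtain ⟨a, rfl⟩ := hψs x
    have h := hR1 a
    simp only [hRψ, MonoidHom.mk'_apply] at h
    exact div_eq_one.1 h
  -- §4: the divisor `E` of `M = grB^*𝒫_B` is a witness for `λ_B·λ_B`
  obtain ⟨E, ⟨iE⟩⟩ := exists_iso_lineBundle_toUnitCocycle (hasRank_pullback grB DB.hasRank_one)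
  refine ⟨E, fun x => ?_, ⟨iE.symm⟩⟩
  have hEc : CechPic.pullback grB (detClass (HasRank.isFiniteLocallyFree' DB.hasRank_one)) = E.cechClass := by
    rw [← detClass_pullback grB (HasRank.isFiniteLocallyFree' DB.hasRank_one)]
    exact detClass_eq_cechClass_of_iso iE _
  refine (nonempty_iso_iff_detClass_eq (hasRank_pullback _ DB.hasRank_one) (B.hasRank_translateTensorDual s E x)
    ((HasRank.isFiniteLocallyFree' DB.hasRank_one).pullback _)
    (HasRank.isFiniteLocallyFree' (B.hasRank_translateTensorDual s E x))).2 ?_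
  rw [detClass_pullback _ (HasRank.isFiniteLocallyFree' DB.hasRank_one),
    B.detClass_translationPullback_tensor_dual s E x (HasRank.isFiniteLocallyFree' (B.hasRank_translateTensorDual s E x))]
  rw [pow_two, DB.pullback_sliceAt_detClass_mul_hom s lamB lamB hDB x, ← pow_two, ← main x, ← hEc]
  exact div_eq_mul_inv _ _

end Transport

end AbelianSchemeOver

end Literature.AlgebraicGeometry.AbelianSchemes

end
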